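import Mathlib
import Summits.NavierStokesRegularity.NavierStokesRegularity.Theorems.TaoLadderRungTwoBreakBlowupRigidityOneOrderedIgnition
import HarnessLib

/-!
# THE BLOW-UP IS SLOW AT SMALL SCALE RATIO: `T⋆² ≥ 1/(4 C_A² E₀ (Λ²-1))`, and the UPPER CLOCK
  `T⋆ - s_n ≥ Λ^{-2n}/(4 C_A² T⋆ E₀ (Λ²-1))` of the first-lit times along an exact cascade blow-up — support for
  `stub_eternalFromBlowup` of K2(1) `TaoLadderRungTwoBreak.BlowupRigidityOne` (stmt-NavierStokesRegularity-20206)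

MODEL lattice ODEs only (Tao 2016 §4 (4.3), Lemma 4.1 (4.5)–(4.10), (4.12), §6.4); nothing here is a statement about the
Navier–Stokes equations; NO item is closed (`--supports stmt-NavierStokesRegularity-20206`). General `m`; DEF-FREE.

Feeding the ENERGY BOUND `‖x_n(t)‖ ≤ √E₀` (`E₀ = Σ X₀ᵢ²`, `partialEnergy_le_datumEnergy`) as the peak bound
`U_n = C_A T Λ^{n+1} √E₀` into the hop-time chain of `OrderedIgnition` (`s_{n+1} - s_n ≥ T/(4U_n²)` for the first-lit
times `s_n` of the normalised amplitudes `u_n = C_A T Λ^{n+1}‖x_n‖` at level `1/2`) and summing the geometric tail: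
* `exists_firstLitTimes` — the first-lit times as a sequence: `0 ≤ s_n < T`, unlit before `s_n`, `s_n` is the greatest
  lower bound of the lit times, and `s_n + T/(4U_n²) ≤ s_{n+1}` for any peak bounds `U`;
* `remainingTime_lower_bound` — **UPPER CLOCK**: if shell `n` is unlit on `[0,r)` then
  `Λ^{-2n} ≤ 4 C_A² T E₀ (Λ²-1) · (T - r)`: the blow-up lags the lighting of shell `n` by `≳ Λ^{-2n}`; in log-time
  `σ = -log(T⋆-t)` the first-lit schedule obeys `σ_n ≤ 2n log Λ + log(4 C_A² T⋆ E₀ (Λ²-1))` — at most LINEAR, slope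
  `2 log Λ = 5 log(1+ε₀)` (a DSS front has slope = its delay `T'`);
* `blowupTime_lower_bound` — `n = 0`: `1 ≤ 4 C_A² T² E₀ (Λ² - 1)`, and `Λ² - 1 = (1+ε₀)⁵ - 1 ≤ 5ε₀(1+ε₀)⁴`
  (`bigLam_sq_sub_one_le`), so `1 ≤ 20 C_A² T² E₀ ε₀ (1+ε₀)⁴`: **an exact cascade blow-up from a one-shell datum takes
  time `T ≥ (2 C_A (1+ε₀)²)⁻¹ (5 E₀ ε₀)^{-1/2}`, which DIVERGES as the scale ratio `1+ε₀ → 1`**;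
* `slowBlowup_of_noGlobalCascade` — the package along the maximal exact flow of every robust blow-up of a table
  `α ∈ E₂(R)` (`C_A ≤ m³`): `1 ≤ 20 m⁶ T⋆² E₀ ε₀ (1+ε₀)⁴` and the upper clock on every shell.

HONEST LABEL. Unconditional a-priori dynamics at the CRITICAL scaling; the first statement of this item's file set in which
`ε₀ → 0` enters favourably (robust blow-up at fixed spread, if it exists below threshold, is SLOW: `T⋆ ≳ ε₀^{-1/2}`), but
`NoGlobalCascade` carries no time limit, so nothing here bears on the Target; the stub's (S₁)-survival, the action ceiling,
periodicity and `stub_eternalIsDSS` are untouched. No stub, crux or summit is proved; rung 0.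
-/

noncomputable section

-- the summit and its single sub-problem share the name (CONVENTIONS §1)
set_option linter.dupNamespace false

open Set Filter Topology MeasureTheory intervalIntegral

namespace Summit.NavierStokesRegularity.NavierStokesRegularity.Theorems

namespace BlowupRigidityOne

open Literature.Analysis.FluidPDE Literature.Analysis.FluidPDE.TaoCascade

variable {m : ℕ}

/-- **Shell-vector energy bound**: `‖x_n(t)‖ ≤ √(Σ X₀ᵢ²)` for every shell `n ∈ ℤ` along an exact flow from the one-shell
datum at shell `0` (cancelling table). [cite: Tao2016AveragedNS, §4 (4.3), Lemma 4.1 (4.9)–(4.10)] -/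
theorem norm_shellVec_le_sqrt_datumEnergy {ε₀ T : ℝ} (hε : 0 < ε₀)
    {α : Fin m → Fin m → Fin m → ℤ × ℤ × ℤ → ℝ} (hc : IsCancellingCoeff α)
    {X : Fin m → ℤ → ℝ → ℝ} {X₀ : Fin m → ℝ}
    (hder : ∀ i k, ∀ t ∈ Ico 0 T, HasDerivWithinAt (X i k) (quadTerm ε₀ α X i k t) (Ici 0) t)
    (hinit : ∀ i k, X i k 0 = if k = 0 then X₀ i else 0)
    (hlow : ∀ i k t, k < 0 → X i k t = 0)
    (hreg : ∀ T' : ℝ, T' < T → ∃ M : ℝ, ∀ t ∈ Icc 0 T', ∀ (i : Fin m) (k : ℤ),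
      (1 + (1 + ε₀) ^ ((10 : ℝ) * k)) * |X i k t| ≤ M)
    (n : ℤ) : ∀ t ∈ Ico 0 T, ‖shellVec X n t‖ ≤ Real.sqrt (∑ i, X₀ i ^ 2) := by
  intro t ht
  rcases lt_or_ge n 0 with hn | hn
  · have h0 : shellVec X n t = 0 := by
      ext j; rw [shellVec_apply, hlow j n t hn]; rfl
    rw [h0, norm_zero]; exact Real.sqrt_nonneg _
  · obtain ⟨n', rfl⟩ := Int.eq_ofNat_of_zero_le hn
    have hE := partialEnergy_le_datumEnergy hε hc hder hinit hlow hreg t ht n'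
    have h1 : ‖shellVec X (n' : ℤ) t‖ ^ 2 ≤ ∑ k ∈ Finset.range (n' + 1), ‖shellVec X (k : ℤ) t‖ ^ 2 :=
      Finset.single_le_sum (f := fun k : ℕ => ‖shellVec X (k : ℤ) t‖ ^ 2) (fun _ _ => by positivity)
        (Finset.mem_range.2 (Nat.lt_succ_self n'))
    rw [← Real.sqrt_sq (norm_nonneg (shellVec X (n' : ℤ) t))]
    exact Real.sqrt_le_sqrt (h1.trans hE)

/-- **THE FIRST-LIT TIMES AS A SEQUENCE.** Along an exact blow-up flow (critical amplitude unbounded) from a one-shell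
datum there are times `s_n ∈ [0,T)` (`s_n = inf{s : u_n(s) ≥ 1/2}`, `u_n = C_A T Λ^{n+1}‖x_n‖`) with: `u_n < 1/2` on
`[0,s_n)`; `s_n ≤ r` whenever `u_n(r) ≥ 1/2`; and `s_n + T/(4U_n²) ≤ s_{n+1}` for any peak bounds `u_n ≤ U_n` on `[0,T)`.
[cite: Tao2016AveragedNS, §4 (4.3), Lemma 4.1 (4.5), (4.8)–(4.10), Thm. 4.2 (statement shape); §1.2] -/
theorem exists_firstLitTimes {ε₀ T : ℝ} (hε : 0 < ε₀) (hT : 0 < T)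
    {α : Fin m → Fin m → Fin m → ℤ × ℤ × ℤ → ℝ} (hc : IsCancellingCoeff α)
    {X : Fin m → ℤ → ℝ → ℝ} {X₀ : Fin m → ℝ}
    (hder : ∀ i k, ∀ t ∈ Ico 0 T, HasDerivWithinAt (X i k) (quadTerm ε₀ α X i k t) (Ici 0) t)
    (hinit : ∀ i k, X i k 0 = if k = 0 then X₀ i else 0)
    (hlow : ∀ i k t, k < 0 → X i k t = 0)
    (hreg : ∀ T' : ℝ, T' < T → ∃ M : ℝ, ∀ t ∈ Icc 0 T', ∀ (i : Fin m) (k : ℤ),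
      (1 + (1 + ε₀) ^ ((10 : ℝ) * k)) * |X i k t| ≤ M)
    (hcrit : ∀ L : ℝ, ∃ t : ℝ, 0 ≤ t ∧ t < T ∧
      ∃ (i : Fin m) (k : ℤ), L < (1 + ε₀) ^ ((5 : ℝ) * k / 2) * |X i k t|) :
    ∃ σ : ℕ → ℝ, (∀ n, 0 ≤ σ n ∧ σ n < T) ∧
      (∀ n : ℕ, ∀ s ∈ Ico 0 (σ n), fluxConst α * T * bigLam ε₀ ^ (n + 1) * ‖shellVec X (n : ℤ) s‖ < 1 / 2) ∧
      (∀ n : ℕ, ∀ r ∈ Ico 0 T, 1 / 2 ≤ fluxConst α * T * bigLam ε₀ ^ (n + 1) * ‖shellVec X (n : ℤ) r‖ → σ n ≤ r) ∧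
      (∀ n : ℕ, ∀ r : ℝ,
        (∀ t' ∈ Ico 0 T, 1 / 2 ≤ fluxConst α * T * bigLam ε₀ ^ (n + 1) * ‖shellVec X (n : ℤ) t'‖ → r ≤ t') → r ≤ σ n) ∧
      (∀ U : ℕ → ℝ, (∀ n : ℕ, ∀ s ∈ Ico 0 T, fluxConst α * T * bigLam ε₀ ^ (n + 1) * ‖shellVec X (n : ℤ) s‖ ≤ U n) →
        ∀ n, σ n + T / 4 * (U n ^ 2)⁻¹ ≤ σ (n + 1)) := by
  have hfire := everyShellFires hε hT hc hder hinit hlow hreg hcrit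
  let S : ℕ → Set ℝ := fun n =>
    {s | 0 ≤ s ∧ s < T ∧ 1 / 2 ≤ fluxConst α * T * bigLam ε₀ ^ (n + 1) * ‖shellVec X (n : ℤ) s‖}
  have hSne : ∀ n, (S n).Nonempty := fun n => by
    obtain ⟨t, ht0, htT, hlt⟩ := hfire n
    exact ⟨t, ht0, htT, by linarith⟩
  have hSbdd : ∀ n, BddBelow (S n) := fun n => ⟨0, fun s hs => hs.1⟩
  have hσ0 : ∀ n, 0 ≤ sInf (S n) := fun n => le_csInf (hSne n) fun s hs => hs.1
  have hσT : ∀ n, sInf (S n) < T := fun n => by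
    obtain ⟨t, ht⟩ := hSne n
    exact lt_of_le_of_lt (csInf_le (hSbdd n) ht) ht.2.1
  have hunlit : ∀ n, ∀ s ∈ Ico 0 (sInf (S n)),
      fluxConst α * T * bigLam ε₀ ^ (n + 1) * ‖shellVec X (n : ℤ) s‖ < 1 / 2 := fun n s hs => by
    by_contra h
    push Not at h
    exact notMem_of_lt_csInf hs.2 (hSbdd n) ⟨hs.1, lt_trans hs.2 (hσT n), h⟩
  refine ⟨fun n => sInf (S n), fun n => ⟨hσ0 n, hσT n⟩, hunlit,
    fun n r hr hlit => csInf_le (hSbdd n) ⟨hr.1, hr.2, hlit⟩,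
    fun n r h => le_csInf (hSne n) fun s hs => h s ⟨hs.1, hs.2.1⟩ hs.2.2, fun U hU n => ?_⟩
  have hUpos : 0 < U n := by
    obtain ⟨t, ht0, htT, hlt⟩ := hfire n
    exact lt_trans zero_lt_one (hlt.trans_le (hU n t ⟨ht0, htT⟩))
  refine le_csInf (hSne (n + 1)) fun r hr => ?_
  have h := hopTime hε hT hc hder hinit hlow hreg n (a := sInf (S n)) (r := r) (U := U n) ⟨hσ0 n, hσT n⟩
    ⟨hr.1, hr.2.1⟩ (hunlit n) hr.2.2 (hU n)
  have hU2 : 0 < U n ^ 2 := pow_pos hUpos 2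
  have : T / 4 * (U n ^ 2)⁻¹ < r - sInf (S n) := by
    rw [← div_eq_mul_inv, div_lt_iff₀ hU2]; exact h.2
  linarith

/-- **UPPER CLOCK: the blow-up lags the lighting of shell `n` by `≳ Λ^{-2n}`.** Along an exact blow-up flow from a one-shell
datum (cancelling table, `E₀ = Σ X₀ᵢ²`): if shell `n` is unlit on `[0,r)` (`C_A T Λ^{n+1}‖x_n(s)‖ < 1/2` for
`0 ≤ s < r`; then automatically `r < T`), then `(Λ²)⁻¹^n ≤ 4 C_A² T E₀ (Λ² - 1) · (T - r)` (geometric tail of the hop times with the energy peak bound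
`U_j = C_A T Λ^{j+1} √E₀`). In log-time: `σ_n ≤ 2n log Λ + log(4 C_A² T E₀ (Λ²-1))` at the first-lit times.
[cite: Tao2016AveragedNS, §4 (4.3), Lemma 4.1 (4.5), (4.8)–(4.10), Thm. 4.2 (statement shape), §6.4; §1.2] -/
theorem remainingTime_lower_bound {ε₀ T : ℝ} (hε : 0 < ε₀) (hT : 0 < T)
    {α : Fin m → Fin m → Fin m → ℤ × ℤ × ℤ → ℝ} (hc : IsCancellingCoeff α)
    {X : Fin m → ℤ → ℝ → ℝ} {X₀ : Fin m → ℝ}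
    (hder : ∀ i k, ∀ t ∈ Ico 0 T, HasDerivWithinAt (X i k) (quadTerm ε₀ α X i k t) (Ici 0) t)
    (hinit : ∀ i k, X i k 0 = if k = 0 then X₀ i else 0)
    (hlow : ∀ i k t, k < 0 → X i k t = 0)
    (hreg : ∀ T' : ℝ, T' < T → ∃ M : ℝ, ∀ t ∈ Icc 0 T', ∀ (i : Fin m) (k : ℤ),
      (1 + (1 + ε₀) ^ ((10 : ℝ) * k)) * |X i k t| ≤ M)
    (hcrit : ∀ L : ℝ, ∃ t : ℝ, 0 ≤ t ∧ t < T ∧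
      ∃ (i : Fin m) (k : ℤ), L < (1 + ε₀) ^ ((5 : ℝ) * k / 2) * |X i k t|)
    (n : ℕ) {r : ℝ}
    (hunlit : ∀ s ∈ Ico 0 r, fluxConst α * T * bigLam ε₀ ^ (n + 1) * ‖shellVec X (n : ℤ) s‖ < 1 / 2) :
    ((bigLam ε₀ ^ 2)⁻¹) ^ n ≤
      4 * fluxConst α ^ 2 * T * (∑ i, X₀ i ^ 2) * (bigLam ε₀ ^ 2 - 1) * (T - r) := by
  have hL : 0 < bigLam ε₀ := bigLam_pos (by linarith)
  have hL1 : 1 < bigLam ε₀ := Real.one_lt_rpow (by linarith) (by norm_num)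
  have hL2 : 1 < bigLam ε₀ ^ 2 := one_lt_pow₀ hL1 two_ne_zero
  have hCA : 0 ≤ fluxConst α := fluxConst_nonneg α
  set E₀ : ℝ := ∑ i, X₀ i ^ 2 with hE₀
  set D : ℝ := Real.sqrt E₀ with hD
  have hD0 : 0 ≤ D := Real.sqrt_nonneg _
  set q : ℝ := (bigLam ε₀ ^ 2)⁻¹ with hq
  have hq0 : 0 < q := by positivity
  have hq1 : q < 1 := inv_lt_one_of_one_lt₀ hL2
  -- peak bounds from the energy bound
  set U : ℕ → ℝ := fun j => fluxConst α * T * bigLam ε₀ ^ (j + 1) * D with hUdef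
  have hU : ∀ j : ℕ, ∀ s ∈ Ico (0:ℝ) T, fluxConst α * T * bigLam ε₀ ^ (j + 1) * ‖shellVec X (j : ℤ) s‖ ≤ U j :=
    fun j s hs => mul_le_mul_of_nonneg_left (norm_shellVec_le_sqrt_datumEnergy hε hc hder hinit hlow hreg j s hs)
      (by positivity)
  obtain ⟨σ, hσ, hσunlit, -, hσglb, hhop⟩ := exists_firstLitTimes hε hT hc hder hinit hlow hreg hcrit
  have hfire := everyShellFires hε hT hc hder hinit hlow hreg hcrit
  -- `C_A T D > 0` (shell `0` fires), hence `C_A, D, E₀ > 0`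
  have hK : 0 < fluxConst α * T * D := by
    obtain ⟨t, ht0, htT, hlt⟩ := hfire 0
    have h := hU 0 t ⟨ht0, htT⟩
    simp only [hUdef, zero_add, pow_one] at h hlt
    have h1 : 0 < fluxConst α * T * bigLam ε₀ * D := lt_trans zero_lt_one (hlt.trans_le h)
    have h2 : fluxConst α * T * bigLam ε₀ * D = (fluxConst α * T * D) * bigLam ε₀ := by ring
    rw [h2] at h1
    exact pos_of_mul_pos_left h1 hL.le
  have hE0 : 0 < E₀ := by
    have hD' : 0 < D := pos_of_mul_pos_right hK (by positivity)
    have := Real.sqrt_pos.1 hD'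
    exact this
  have hD2 : D ^ 2 = E₀ := Real.sq_sqrt hE0.le
  have hCApos : 0 < fluxConst α := by
    have : 0 < fluxConst α * (T * D) := by rw [← mul_assoc]; exact hK
    exact pos_of_mul_pos_left this (by positivity)
  -- `r ≤ σ n`: every lit time of shell `n` is `≥ r`
  have hrσ : r ≤ σ n := hσglb n r fun t' ht' hl => by
    by_contra h'
    push Not at h'
    exact absurd (hunlit t' ⟨ht'.1, h'⟩) (not_lt.2 hl)
  -- the hop chain from shell `n`
  have hhopU := hhop U hU
  have hchain : ∀ k : ℕ, σ n + ∑ j ∈ Finset.range k, T / 4 * (U (n + j) ^ 2)⁻¹ ≤ σ (n + k) := by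
    intro k
    induction k with
    | zero => simp
    | succ k ih =>
      rw [Finset.sum_range_succ, show n + (k + 1) = n + k + 1 by ring]
      linarith [hhopU (n + k)]
  have hpartial : ∀ k : ℕ, ∑ j ∈ Finset.range k, T / 4 * (U (n + j) ^ 2)⁻¹ ≤ T - r := fun k => by
    linarith [hchain k, (hσ (n + k)).2, hrσ]
  -- the terms are geometric: `T/4 (U_{n+j}²)⁻¹ = C0 q^j`
  set C0 : ℝ := T / 4 * ((fluxConst α * T * D) ^ 2)⁻¹ * q ^ (n + 1) with hC0
  have hterm : ∀ j : ℕ, T / 4 * (U (n + j) ^ 2)⁻¹ = C0 * q ^ j := by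
    intro j
    have hqpow : ∀ k : ℕ, q ^ k = ((bigLam ε₀ ^ k) ^ 2)⁻¹ := fun k => by
      rw [hq, inv_pow, ← pow_mul, mul_comm, pow_mul]
    rw [hC0, hUdef, mul_assoc (T / 4 * ((fluxConst α * T * D) ^ 2)⁻¹), ← pow_add, hqpow]
    simp only
    have hne : fluxConst α * T * D ≠ 0 := hK.ne'
    have hΛne : bigLam ε₀ ≠ 0 := hL.ne'
    field_simp
    ring
  have hsum : HasSum (fun j : ℕ => C0 * q ^ j) (C0 * (1 - q)⁻¹) :=
    (hasSum_geometric_of_lt_one hq0.le hq1).mul_left C0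
  have hlim : C0 * (1 - q)⁻¹ ≤ T - r := by
    refine le_of_tendsto' hsum.tendsto_sum_nat fun k => ?_
    calc ∑ j ∈ Finset.range k, C0 * q ^ j = ∑ j ∈ Finset.range k, T / 4 * (U (n + j) ^ 2)⁻¹ :=
          Finset.sum_congr rfl fun j _ => (hterm j).symm
      _ ≤ T - r := hpartial k
  -- algebra: `C0 (1-q)⁻¹ = qⁿ / (4 C_A² T E₀ (Λ²-1))`
  have hP : 0 < 4 * fluxConst α ^ 2 * T * E₀ * (bigLam ε₀ ^ 2 - 1) := by
    have : 0 < bigLam ε₀ ^ 2 - 1 := by linarith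
    positivity
  have hid : C0 * (1 - q)⁻¹ * (4 * fluxConst α ^ 2 * T * E₀ * (bigLam ε₀ ^ 2 - 1)) = q ^ n := by
    have hΛ2 : bigLam ε₀ ^ 2 = q⁻¹ := by rw [hq, inv_inv]
    rw [hC0, ← hD2, hΛ2]
    have hqne : q ≠ 0 := hq0.ne'
    have hq1ne : 1 - q ≠ 0 := by linarith
    have hDne : D ≠ 0 := (Real.sqrt_pos.2 hE0).ne'
    have hCne : fluxConst α ≠ 0 := hCApos.ne'
    have hTne : T ≠ 0 := hT.ne'
    field_simp
    ring
  calc ((bigLam ε₀ ^ 2)⁻¹) ^ n = q ^ n := by rw [hq]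
    _ = C0 * (1 - q)⁻¹ * (4 * fluxConst α ^ 2 * T * E₀ * (bigLam ε₀ ^ 2 - 1)) := hid.symm
    _ ≤ (T - r) * (4 * fluxConst α ^ 2 * T * E₀ * (bigLam ε₀ ^ 2 - 1)) :=
        mul_le_mul_of_nonneg_right hlim hP.le
    _ = 4 * fluxConst α ^ 2 * T * E₀ * (bigLam ε₀ ^ 2 - 1) * (T - r) := by ring


/-- **BLOW-UP TIME LOWER BOUND**: `1 ≤ 4 C_A² T² E₀ (Λ² - 1)` for every exact cascade blow-up from a one-shell datum
(cancelling table; `E₀ = Σ X₀ᵢ²`, `Λ² = (1+ε₀)⁵`) — the case `n = 0`, `r = 0` of `remainingTime_lower_bound`.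
[cite: Tao2016AveragedNS, §4 (4.3), Lemma 4.1 (4.5), (4.8)–(4.10), Thm. 4.2 (statement shape); §1.2] -/
theorem blowupTime_lower_bound {ε₀ T : ℝ} (hε : 0 < ε₀) (hT : 0 < T)
    {α : Fin m → Fin m → Fin m → ℤ × ℤ × ℤ → ℝ} (hc : IsCancellingCoeff α)
    {X : Fin m → ℤ → ℝ → ℝ} {X₀ : Fin m → ℝ}
    (hder : ∀ i k, ∀ t ∈ Ico 0 T, HasDerivWithinAt (X i k) (quadTerm ε₀ α X i k t) (Ici 0) t)
    (hinit : ∀ i k, X i k 0 = if k = 0 then X₀ i else 0)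
    (hlow : ∀ i k t, k < 0 → X i k t = 0)
    (hreg : ∀ T' : ℝ, T' < T → ∃ M : ℝ, ∀ t ∈ Icc 0 T', ∀ (i : Fin m) (k : ℤ),
      (1 + (1 + ε₀) ^ ((10 : ℝ) * k)) * |X i k t| ≤ M)
    (hcrit : ∀ L : ℝ, ∃ t : ℝ, 0 ≤ t ∧ t < T ∧
      ∃ (i : Fin m) (k : ℤ), L < (1 + ε₀) ^ ((5 : ℝ) * k / 2) * |X i k t|) :
    1 ≤ 4 * fluxConst α ^ 2 * T ^ 2 * (∑ i, X₀ i ^ 2) * (bigLam ε₀ ^ 2 - 1) := by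
  have h := remainingTime_lower_bound hε hT hc hder hinit hlow hreg hcrit 0 (r := 0)
    (fun s hs => absurd hs.2 (not_lt.2 hs.1))
  rw [pow_zero, sub_zero] at h
  linarith

/-- `Λ² - 1 = (1+ε₀)⁵ - 1 ≤ 5 ε₀ (1+ε₀)⁴` for `ε₀ ≥ 0`. [cite: Tao2016AveragedNS, §4 (4.1) (`Λ = (1+ε₀)^{5/2}`)] -/
theorem bigLam_sq_sub_one_le {ε₀ : ℝ} (hε : 0 ≤ ε₀) : bigLam ε₀ ^ 2 - 1 ≤ 5 * ε₀ * (1 + ε₀) ^ 4 := by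
  rw [bigLam_sq hε]
  nlinarith [pow_nonneg hε 2, pow_nonneg hε 3, pow_nonneg hε 4, pow_nonneg hε 5,
    mul_nonneg (pow_nonneg hε 2) (pow_nonneg hε 3)]

/-- **THE BLOW-UP IS SLOW AT SMALL SCALE RATIO**: `1 ≤ 20 C_A² T² E₀ ε₀ (1+ε₀)⁴`, i.e.
`T ≥ (2 C_A (1+ε₀)²)⁻¹ (5 E₀ ε₀)^{-1/2}`, for every exact cascade blow-up from a one-shell datum (cancelling table).
[cite: Tao2016AveragedNS, §4 (4.3), Lemma 4.1 (4.5), (4.8)–(4.10), Thm. 4.2 (statement shape); §1.2] -/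
theorem blowupTime_lower_bound_eps {ε₀ T : ℝ} (hε : 0 < ε₀) (hT : 0 < T)
    {α : Fin m → Fin m → Fin m → ℤ × ℤ × ℤ → ℝ} (hc : IsCancellingCoeff α)
    {X : Fin m → ℤ → ℝ → ℝ} {X₀ : Fin m → ℝ}
    (hder : ∀ i k, ∀ t ∈ Ico 0 T, HasDerivWithinAt (X i k) (quadTerm ε₀ α X i k t) (Ici 0) t)
    (hinit : ∀ i k, X i k 0 = if k = 0 then X₀ i else 0)
    (hlow : ∀ i k t, k < 0 → X i k t = 0)
    (hreg : ∀ T' : ℝ, T' < T → ∃ M : ℝ, ∀ t ∈ Icc 0 T', ∀ (i : Fin m) (k : ℤ),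
      (1 + (1 + ε₀) ^ ((10 : ℝ) * k)) * |X i k t| ≤ M)
    (hcrit : ∀ L : ℝ, ∃ t : ℝ, 0 ≤ t ∧ t < T ∧
      ∃ (i : Fin m) (k : ℤ), L < (1 + ε₀) ^ ((5 : ℝ) * k / 2) * |X i k t|) :
    1 ≤ 20 * fluxConst α ^ 2 * T ^ 2 * (∑ i, X₀ i ^ 2) * ε₀ * (1 + ε₀) ^ 4 := by
  have h1 := blowupTime_lower_bound hε hT hc hder hinit hlow hreg hcrit
  have h2 := bigLam_sq_sub_one_le hε.le
  have h0 : 0 ≤ 4 * fluxConst α ^ 2 * T ^ 2 * (∑ i, X₀ i ^ 2) := by positivity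
  nlinarith [mul_le_mul_of_nonneg_left h2 h0]

/-! ### Along a robust blow-up -/

/-- **ROBUST BLOW-UP IS SLOW AT SMALL SCALE RATIO, WITH AN UPPER CLOCK.** If `NoGlobalCascade ε₀ α X₀` (`ε₀ > 0`,
`α ∈ E₂(R)`, any `m`; `C_A ≤ m³`), then the maximal exact cascade flow `X` from the one-shell datum on `[0,T⋆)`
(`criticalBlowup_of_noGlobalCascade`) has `1 ≤ 20 m⁶ T⋆² E₀ ε₀ (1+ε₀)⁴` (`E₀ = Σ X₀ᵢ²`), and on every shell the UPPER
CLOCK: if shell `n` is unlit on `[0,r)` then `(Λ²)⁻¹^n ≤ 4 m⁶ T⋆ E₀ (Λ²-1)(T⋆ - r)`.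
[cite: Tao2016AveragedNS, §4 Thm. 4.2 (statement shape), (4.1)–(4.3), Lemma 4.1 (4.5), (4.8)–(4.10), (4.12), §6.4; §1.2] -/
theorem slowBlowup_of_noGlobalCascade {ε₀ R : ℝ} (hε : 0 < ε₀)
    {α : Fin m → Fin m → Fin m → ℤ × ℤ × ℤ → ℝ} {X₀ : Fin m → ℝ} (hα : InTableClass R α)
    (hNG : NoGlobalCascade ε₀ α X₀) :
    ∃ (T : ℝ) (X : Fin m → ℤ → ℝ → ℝ), 0 < T ∧
      (∀ i n, ContDiffOn ℝ 1 (X i n) (Set.Ico 0 T)) ∧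
      (∀ i n, X i n 0 = if n = 0 then X₀ i else 0) ∧
      (∀ i n t, n < 0 → X i n t = 0) ∧
      (∀ i n t, 0 ≤ t → t < T → derivWithin (X i n) (Set.Ici 0) t = quadTerm ε₀ α X i n t) ∧
      (∀ T' : ℝ, 0 < T' → T' < T → ∃ M : ℝ, ∀ t : ℝ, 0 ≤ t → t ≤ T' →
        ∀ (i : Fin m) (n : ℤ), (1 + (1 + ε₀) ^ ((10 : ℝ) * n)) * |X i n t| ≤ M) ∧
      1 ≤ 20 * (m : ℝ) ^ 6 * T ^ 2 * (∑ i, X₀ i ^ 2) * ε₀ * (1 + ε₀) ^ 4 ∧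
      (∀ (n : ℕ) (r : ℝ), (∀ s ∈ Ico (0:ℝ) r,
          fluxConst α * T * bigLam ε₀ ^ (n + 1) * ‖shellVec X (n : ℤ) s‖ < 1 / 2) →
        ((bigLam ε₀ ^ 2)⁻¹) ^ n ≤ 4 * (m : ℝ) ^ 6 * T * (∑ i, X₀ i ^ 2) * (bigLam ε₀ ^ 2 - 1) * (T - r)) := by
  obtain ⟨T, X, hT, h1, h2, h3, h4, h5, h6⟩ := criticalBlowup_of_noGlobalCascade hε hα hNG
  have hder : ∀ i k, ∀ τ ∈ Ico (0 : ℝ) T,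
      HasDerivWithinAt (X i k) (quadTerm ε₀ α X i k τ) (Ici 0) τ := by
    intro i k τ hτ
    have hd : DifferentiableWithinAt ℝ (X i k) (Ico 0 T) τ :=
      ((h1 i k).differentiableOn one_ne_zero) τ hτ
    have hd' : DifferentiableWithinAt ℝ (X i k) (Ici 0) τ :=
      hd.mono_of_mem_nhdsWithin (by
        rw [mem_nhdsWithin]
        exact ⟨Iio T, isOpen_Iio, hτ.2, fun x hx => ⟨hx.2, hx.1⟩⟩)
    rw [← h4 i k τ hτ.1 hτ.2]
    exact hd'.hasDerivWithinAt
  have hreg : ∀ T' : ℝ, T' < T → ∃ M : ℝ, ∀ τ ∈ Icc (0 : ℝ) T', ∀ (i : Fin m) (k : ℤ),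
      (1 + (1 + ε₀) ^ ((10 : ℝ) * k)) * |X i k τ| ≤ M := by
    intro T' hT'
    rcases le_or_gt T' 0 with h0 | h0
    · obtain ⟨M, hM⟩ := h5 (T / 2) (by linarith) (by linarith)
      exact ⟨M, fun τ hτ i k => hM τ hτ.1 (by linarith [hτ.2]) i k⟩
    · obtain ⟨M, hM⟩ := h5 T' h0 hT'
      exact ⟨M, fun τ hτ i k => hM τ hτ.1 hτ.2 i k⟩
  -- `C_A ≤ m³` on the comparable class
  have hCA : 0 ≤ fluxConst α := fluxConst_nonneg α
  have hCA3 : fluxConst α ≤ (m : ℝ) ^ 3 :=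
    fluxConst_le_of_abs_le_one α fun i₁ i₂ i₃ => abs_le_one_of_inTableClass hα i₁ i₂ i₃ (0, 0, 1) (by decide)
  have hCA6 : fluxConst α ^ 2 ≤ (m : ℝ) ^ 6 := by
    calc fluxConst α ^ 2 ≤ ((m : ℝ) ^ 3) ^ 2 := pow_le_pow_left₀ hCA hCA3 2
      _ = (m : ℝ) ^ 6 := by ring
  have hE0 : 0 ≤ ∑ i, X₀ i ^ 2 := Finset.sum_nonneg fun i _ => sq_nonneg _
  have hL1 : 1 < bigLam ε₀ := Real.one_lt_rpow (by linarith) (by norm_num)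
  have hL2 : 0 ≤ bigLam ε₀ ^ 2 - 1 := by nlinarith
  refine ⟨T, X, hT, h1, h2, h3, h4, h5, ?_, fun n r hun => ?_⟩
  · have h := blowupTime_lower_bound_eps hε hT hα.2.1 hder h2 h3 hreg h6
    have hmono : 20 * fluxConst α ^ 2 * T ^ 2 * (∑ i, X₀ i ^ 2) * ε₀ * (1 + ε₀) ^ 4 ≤
        20 * (m : ℝ) ^ 6 * T ^ 2 * (∑ i, X₀ i ^ 2) * ε₀ * (1 + ε₀) ^ 4 := by
      have : 0 ≤ 20 * T ^ 2 * (∑ i, X₀ i ^ 2) * ε₀ * (1 + ε₀) ^ 4 := by positivity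
      nlinarith [mul_le_mul_of_nonneg_left hCA6 this]
    exact h.trans hmono
  · have h := remainingTime_lower_bound hε hT hα.2.1 hder h2 h3 hreg h6 n (r := r) hun
    -- `r < T` (shell `n` fires), so `T - r > 0` and the constant may be enlarged
    obtain ⟨t, ht0, htT, hlt⟩ := everyShellFires hε hT hα.2.1 hder h2 h3 hreg h6 n
    have hrT : r ≤ T := by
      by_contra hcon
      push Not at hcon
      exact absurd (hun t ⟨ht0, lt_trans htT hcon⟩) (not_lt.2 (by linarith))
    have hmono : 4 * fluxConst α ^ 2 * T * (∑ i, X₀ i ^ 2) * (bigLam ε₀ ^ 2 - 1) * (T - r) ≤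
        4 * (m : ℝ) ^ 6 * T * (∑ i, X₀ i ^ 2) * (bigLam ε₀ ^ 2 - 1) * (T - r) := by
      have : 0 ≤ 4 * T * (∑ i, X₀ i ^ 2) * (bigLam ε₀ ^ 2 - 1) * (T - r) := by
        have : 0 ≤ T - r := by linarith
        positivity
      nlinarith [mul_le_mul_of_nonneg_left hCA6 this]
    exact h.trans hmono

end BlowupRigidityOne

end Summit.NavierStokesRegularity.NavierStokesRegularity.Theorems

end
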